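import Summits.QuantumFields.YangMills.Theorems.AtomicSynthesisRiemannDiscKernel
import Summits.QuantumFields.YangMills.Theorems.AtomicSynthesisSingleSlotReduction

/-!
# AtomicSynthesis (stmt-QuantumFields-28126), stub `stub_singleSlot` — **H4b `RiemannDisc b N` proved** (every order `N ≥ 1`)

Prover w4 g22 (free hands), closing H4b of planner ym-idea-11 g14's split of the registered stub `stub_singleSlot`
(`Theorems/AtomicSynthesisSingleSlotReduction`: `stubSingleSlot_of_split : (H1) → (∀ b, MolliApprox b 6) → (∀ b, RiemannDisc b 6) →
StubSingleSlotP`; H1 is `momentKilling`, landed; H4a `MolliApprox` remains).  Statement (`RiemannDisc`): the smoothing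
`kSmooth K τ f` of `f` against the scaled finite-combination kernel `K = Σ_j w_j b(· − u_j)` is, for every oversampling `m₀ ≥ 1`,
within `(C₂/m₀)·A/τ^m` in the `m`-th derivative (`m ≤ N`) of a finite combination of translates of `b` at scale `τ` with mass
`≤ C₂ (ϱ/τ)⁴ A` and centres within `ϱ + R₂ τ` of `c`.  Proof: atoms indexed by (mesh point `hk` with `‖hk − c‖ ≤ ϱ`,
`h = τ/m₀`) × `j`, coefficient `h⁴τ⁻⁴ w_j f(hk)`, centre `hk + τ u_j`; the atom sum is the Riemann sum of `y ↦ f(y) Φ_τ(x − y)`,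
`Φ_τ = τ⁻⁴K(τ⁻¹·)`, so the error functional of `AtomicSynthesisRiemannDeriv` applies with `A₀ = A`, `A₁ = A/σ`, `r = τ R_K`,
`M_j = τ⁻⁴τ^{-j} sup‖D^j K‖`, giving `2(τ/m₀)·Aτ^{-5-m}(D_{m+1}+D_m)·τ⁴(R_K+2)⁴vol(B₁) = const·A/(m₀τ^m)`; the mass is
`#mesh · h⁴τ⁻⁴ W A ≤ 7⁴ W (ϱ/τ)⁴ A`.  Constants: `C₂ = 7⁴ Σ|w_j| + 2(R_K+2)⁴ vol(B₁) Σ_{j ≤ N+1} sup‖D^j K‖`,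
`R₂ = R_K = R_b + Σ‖u_j‖`.  No crux/rung/summit is closed; nothing here touches Yang–Mills; the YM mass gap is NOT proved. [folklore]
-/

set_option autoImplicit false

noncomputable section

open scoped BigOperators ContDiff
open MeasureTheory Set Metric Filter
open Literature.MathematicalPhysics.QuantumLattice (siteToE siteToE_apply)
open Summit.QuantumFields.YangMills.Cruxes.AtomicSynthesis.RiemannFloor (smul_siteToE_apply)
open Summit.QuantumFields.YangMills.Cruxes.AtomicSynthesis.RiemannDeriv
open Summit.QuantumFields.YangMills.Cruxes.AtomicSynthesis.RiemannDiscKernel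

namespace Summit.QuantumFields.YangMills.Cruxes.AtomicSynthesis.SingleSlotPlan

/-- The finite-combination kernel is smooth. -/
theorem contDiff_combKernel_top (b : SchwartzMap E4 ℝ) {J₀ : ℕ} (w : Fin J₀ → ℝ) (u : Fin J₀ → E4) :
    ContDiff ℝ ∞ (combKernel b w u) := by
  unfold combKernel
  exact ContDiff.sum fun j _ => contDiff_const.mul ((b.smooth _).comp (contDiff_id.sub contDiff_const))

/-- The finite-combination kernel is supported in `B̄(0, R_b + Σ‖u_j‖)`. -/
theorem tsupport_combKernel_subset (b : SchwartzMap E4 ℝ) {Rb : ℝ} (hRb : tsupport (b : E4 → ℝ) ⊆ closedBall 0 Rb) {J₀ : ℕ}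
    (w : Fin J₀ → ℝ) (u : Fin J₀ → E4) : tsupport (combKernel b w u) ⊆ closedBall 0 (Rb + ∑ j, ‖u j‖) := by
  refine closure_minimal (fun v hv => ?_) isClosed_closedBall
  obtain ⟨j, -, hj⟩ := Finset.exists_ne_zero_of_sum_ne_zero (Function.mem_support.mp hv)
  have hbj : b (v - u j) ≠ 0 := fun h0 => hj (by rw [h0, mul_zero])
  have h1 := hRb (subset_tsupport _ (Function.mem_support.mpr hbj))
  rw [mem_closedBall, dist_zero_right] at h1 ⊢
  have h2 : ‖u j‖ ≤ ∑ j, ‖u j‖ := Finset.single_le_sum (fun i _ => norm_nonneg (u i)) (Finset.mem_univ j)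
  calc ‖v‖ ≤ ‖v - u j‖ + ‖u j‖ := norm_le_norm_sub_add v (u j)
    _ ≤ Rb + ∑ j, ‖u j‖ := add_le_add h1 h2

/-- **H4b: `RiemannDisc b N` holds for every compactly supported Schwartz profile `b` and every order `N ≥ 1`.** [folklore] -/
theorem riemannDisc (b : SchwartzMap E4 ℝ) (N : ℕ) (hN : 1 ≤ N) : RiemannDisc b N := by
  intro hb J₀ w u
  classical
  -- constants of the kernel
  obtain ⟨Rb, hRb0, hRb⟩ := exists_tsupport_subset_closedBall (b : E4 → ℝ) hb
  set U : ℝ := ∑ j, ‖u j‖ with hU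
  set W : ℝ := ∑ j, |w j| with hW
  have hU0 : 0 ≤ U := Finset.sum_nonneg fun j _ => norm_nonneg _
  have hW0 : 0 ≤ W := Finset.sum_nonneg fun j _ => abs_nonneg _
  set K : E4 → ℝ := combKernel b w u with hK
  have hKd : ContDiff ℝ ∞ K := contDiff_combKernel_top b w u
  set RK : ℝ := Rb + U with hRK
  have hRK0 : 0 ≤ RK := add_nonneg hRb0 hU0
  have hKsupp : tsupport K ⊆ closedBall 0 RK := tsupport_combKernel_subset b hRb w u
  have hKc : HasCompactSupport K :=
    HasCompactSupport.of_support_subset_isCompact (isCompact_closedBall 0 RK) ((subset_tsupport K).trans hKsupp)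
  have hDex : ∀ j : ℕ, ∃ C : ℝ, 0 ≤ C ∧ ∀ y, ‖iteratedFDeriv ℝ j K y‖ ≤ C := fun j =>
    exists_norm_le_of_hasCompactSupport _ (hKd.continuous_iteratedFDeriv (by exact_mod_cast le_top))
      (hKc.iteratedFDeriv j)
  choose D hD0 hD using hDex
  -- opaque constants (kept out of reach of `whnf`): the unit-ball volume and the sum of the derivative sups
  obtain ⟨V₁, hV₁⟩ : ∃ V : ℝ, V = (volume (ball (0 : E4) 1)).toReal := ⟨_, rfl⟩
  have hV₁0 : 0 ≤ V₁ := by rw [hV₁]; exact ENNReal.toReal_nonneg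
  obtain ⟨Dsum, hDsum⟩ : ∃ Ds : ℝ, Ds = ∑ j ∈ Finset.range (N + 2), D j := ⟨_, rfl⟩
  have hDsum0 : 0 ≤ Dsum := by rw [hDsum]; exact Finset.sum_nonneg fun j _ => hD0 j
  have hC0 : 0 ≤ 2 * (RK + 2) ^ 4 * V₁ * Dsum :=
    mul_nonneg (mul_nonneg (mul_nonneg (by norm_num) (pow_nonneg (by linarith) 4)) hV₁0) hDsum0
  refine ⟨7 ^ 4 * W + 2 * (RK + 2) ^ 4 * V₁ * Dsum, RK, add_nonneg (mul_nonneg (by norm_num) hW0) hC0, hRK0, ?_⟩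
  intro f c ϱ σ A τ hf hτ hτσ hσϱ hA hfsupp hfD m₀ hm₀
  -- scales
  have hσ : 0 < σ := hτ.trans_le hτσ
  have hϱ : 0 < ϱ := hσ.trans_le hσϱ
  have hm₀' : (1 : ℝ) ≤ m₀ := by exact_mod_cast hm₀
  have hm₀pos : (0 : ℝ) < m₀ := by linarith
  set h : ℝ := τ / m₀ with hh_def
  have hh : 0 < h := div_pos hτ hm₀pos
  have hhτ : h ≤ τ := div_le_self hτ.le hm₀'
  have hhϱ : h ≤ ϱ := hhτ.trans (hτσ.trans hσϱ)
  -- the scaled kernel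
  set Φ : E4 → ℝ := fun v => (τ ^ 4)⁻¹ * K (τ⁻¹ • v) with hΦ_def
  have hΦd : ContDiff ℝ ∞ Φ := contDiff_scaled K hKd τ
  have hΦsupp : tsupport Φ ⊆ closedBall 0 (τ * RK) := tsupport_scaled_subset K hKsupp hτ
  have hΦM : ∀ j y, ‖iteratedFDeriv ℝ j Φ y‖ ≤ (τ ^ 4)⁻¹ * (τ⁻¹) ^ j * D j :=
    norm_iteratedFDeriv_scaled_le K hKd hτ D hD
  have hMτ0 : ∀ j, 0 ≤ (τ ^ 4)⁻¹ * (τ⁻¹) ^ j * D j := fun j => by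
    have := hD0 j; positivity
  -- the mesh set and the bounds on `f`
  set S : Finset (Fin 4 → ℤ) := meshSet c ϱ h with hS_def
  have hS : ∀ k, f (h • siteToE k) ≠ 0 → k ∈ S := fun k hk => by
    refine mem_meshSet_of_norm_sub_le hh ?_
    have := hfsupp (subset_tsupport _ (Function.mem_support.mpr hk))
    rwa [mem_closedBall, dist_eq_norm] at this
  have hf0 : ∀ y, |f y| ≤ A := abs_le_of_iteratedFDeriv_zero f hfD
  have hf1 : ∀ y y', |f y - f y'| ≤ A / σ * ‖y - y'‖ := lipschitz_of_iteratedFDeriv_one f hf hN hfD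
  -- the atoms, indexed by `↥S × Fin J₀ ≃ Fin J`
  set J : ℕ := Fintype.card ({k // k ∈ S} × Fin J₀) with hJ
  set e : Fin J ≃ {k // k ∈ S} × Fin J₀ := (Fintype.equivFin _).symm with he
  set a : Fin J → ℝ := fun j => h ^ 4 * (τ ^ 4)⁻¹ * w (e j).2 * f (h • siteToE ((e j).1 : Fin 4 → ℤ)) with ha_def
  set η : Fin J → E4 := fun j => h • siteToE ((e j).1 : Fin 4 → ℤ) + τ • u (e j).2 with hη_def
  -- the atom sum is the Riemann sum of `y ↦ f(y) Φ(x − y)`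
  have hrepr : (fun x => ∑ j, a j * b (τ⁻¹ • (x - η j))) =
      fun x => ∑ k ∈ S, (h ^ 4 * f (h • siteToE k)) • Φ (x - h • siteToE k) := by
    funext x
    have e1 : (∑ j, a j * b (τ⁻¹ • (x - η j))) = ∑ p : {k // k ∈ S} × Fin J₀,
        (h ^ 4 * (τ ^ 4)⁻¹ * w p.2 * f (h • siteToE (p.1 : Fin 4 → ℤ))) *
          b (τ⁻¹ • (x - (h • siteToE (p.1 : Fin 4 → ℤ) + τ • u p.2))) :=
      Equiv.sum_comp e (fun p : {k // k ∈ S} × Fin J₀ =>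
        (h ^ 4 * (τ ^ 4)⁻¹ * w p.2 * f (h • siteToE (p.1 : Fin 4 → ℤ))) *
          b (τ⁻¹ • (x - (h • siteToE (p.1 : Fin 4 → ℤ) + τ • u p.2))))
    rw [e1, Fintype.sum_prod_type, Finset.sum_coe_sort S (fun k => ∑ j : Fin J₀,
      (h ^ 4 * (τ ^ 4)⁻¹ * w j * f (h • siteToE k)) * b (τ⁻¹ • (x - (h • siteToE k + τ • u j))))]
    refine Finset.sum_congr rfl fun k _ => ?_
    simp only [hΦ_def, hK, combKernel, smul_eq_mul, Finset.mul_sum]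
    refine Finset.sum_congr rfl fun j _ => ?_
    have : τ⁻¹ • (x - (h • siteToE k + τ • u j)) = τ⁻¹ • (x - h • siteToE k) - u j := by
      rw [← sub_sub, smul_sub, smul_smul, inv_mul_cancel₀ hτ.ne', one_smul]
    rw [this]; ring
  refine ⟨J, a, η, fun j => ?_, ?_, ?_, ?_, ?_⟩
  · -- centres
    have hk := norm_sub_le_of_mem_meshSet (e j).1.2
    have hu : ‖u (e j).2‖ ≤ U := Finset.single_le_sum (fun i _ => norm_nonneg (u i)) (Finset.mem_univ _)
    have hsplit : η j - c = (h • siteToE ((e j).1 : Fin 4 → ℤ) - c) + τ • u (e j).2 := by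
      simp only [hη_def]; abel
    have hRbτ : 0 ≤ Rb * τ := mul_nonneg hRb0 hτ.le
    calc ‖η j - c‖ = ‖(h • siteToE ((e j).1 : Fin 4 → ℤ) - c) + τ • u (e j).2‖ := by rw [hsplit]
      _ ≤ ‖h • siteToE ((e j).1 : Fin 4 → ℤ) - c‖ + ‖τ • u (e j).2‖ := norm_add_le _ _
      _ ≤ ϱ + τ * U := by
          rw [norm_smul, Real.norm_eq_abs, abs_of_pos hτ]
          exact add_le_add hk (mul_le_mul_of_nonneg_left hu hτ.le)
      _ ≤ ϱ + RK * τ := by rw [hRK, add_mul, mul_comm τ U]; linarith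
  · -- mass
    have e1 : (∑ j, |a j|) = ∑ p : {k // k ∈ S} × Fin J₀,
        |h ^ 4 * (τ ^ 4)⁻¹ * w p.2 * f (h • siteToE (p.1 : Fin 4 → ℤ))| :=
      Equiv.sum_comp e (fun p : {k // k ∈ S} × Fin J₀ =>
        |h ^ 4 * (τ ^ 4)⁻¹ * w p.2 * f (h • siteToE (p.1 : Fin 4 → ℤ))|)
    rw [e1, Fintype.sum_prod_type, Finset.sum_coe_sort S (fun k => ∑ j : Fin J₀,
      |h ^ 4 * (τ ^ 4)⁻¹ * w j * f (h • siteToE k)|)]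
    have hterm : ∀ k ∈ S, (∑ j : Fin J₀, |h ^ 4 * (τ ^ 4)⁻¹ * w j * f (h • siteToE k)|) ≤ h ^ 4 * (τ ^ 4)⁻¹ * W * A := by
      intro k _
      rw [hW, Finset.mul_sum, Finset.sum_mul]
      refine Finset.sum_le_sum fun j _ => ?_
      rw [abs_mul, abs_mul, abs_mul, abs_of_pos (pow_pos hh 4), abs_of_pos (inv_pos.2 (pow_pos hτ 4))]
      have h4 : 0 ≤ h ^ 4 * (τ ^ 4)⁻¹ * |w j| := by positivity
      exact mul_le_mul_of_nonneg_left (hf0 (h • siteToE k)) h4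
    have hcard : (S.card : ℝ) ≤ (2 * (ϱ / h) + 5) ^ 4 := card_meshSet_le c hϱ.le hh
    have hX0 : 0 ≤ h ^ 4 * (τ ^ 4)⁻¹ * W * A :=
      mul_nonneg (mul_nonneg (mul_nonneg (pow_nonneg hh.le 4) (inv_nonneg.2 (pow_nonneg hτ.le 4))) hW0) hA
    have hq0 : 0 ≤ 2 * (ϱ / h) + 5 := by positivity
    have h1 : 2 * (ϱ / h) + 5 ≤ 7 * (ϱ / h) := by
      have : 1 ≤ ϱ / h := by rw [le_div_iff₀ hh]; linarith
      linarith
    have hτ0 : τ ≠ 0 := hτ.ne'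
    have hh0 : h ≠ 0 := hh.ne'
    have hQ0 : 0 ≤ (ϱ / τ) ^ 4 * A := by positivity
    calc ∑ k ∈ S, ∑ j : Fin J₀, |h ^ 4 * (τ ^ 4)⁻¹ * w j * f (h • siteToE k)|
        ≤ ∑ k ∈ S, h ^ 4 * (τ ^ 4)⁻¹ * W * A := Finset.sum_le_sum hterm
      _ = (S.card : ℝ) * (h ^ 4 * (τ ^ 4)⁻¹ * W * A) := by rw [Finset.sum_const, nsmul_eq_mul]
      _ ≤ (2 * (ϱ / h) + 5) ^ 4 * (h ^ 4 * (τ ^ 4)⁻¹ * W * A) := mul_le_mul_of_nonneg_right hcard hX0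
      _ ≤ (7 * (ϱ / h)) ^ 4 * (h ^ 4 * (τ ^ 4)⁻¹ * W * A) :=
          mul_le_mul_of_nonneg_right (pow_le_pow_left₀ hq0 h1 4) hX0
      _ = 7 ^ 4 * W * ((ϱ / τ) ^ 4 * A) := by field_simp
      _ ≤ (7 ^ 4 * W + 2 * (RK + 2) ^ 4 * V₁ * Dsum) * ((ϱ / τ) ^ 4 * A) :=
          mul_le_mul_of_nonneg_right (le_add_of_nonneg_right hC0) hQ0
      _ = (7 ^ 4 * W + 2 * (RK + 2) ^ 4 * V₁ * Dsum) * (ϱ / τ) ^ 4 * A := by ring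
  · -- smoothness
    rw [hrepr]
    refine ContDiff.sum fun k _ => ?_
    have hΦk : ContDiff ℝ ∞ (fun x : E4 => Φ (x - h • siteToE k)) := hΦd.comp (contDiff_id.sub contDiff_const)
    change ContDiff ℝ ∞ (fun x : E4 => (h ^ 4 * f (h • siteToE k)) * Φ (x - h • siteToE k))
    exact contDiff_const.mul hΦk
  · -- support
    rw [hrepr]
    refine closure_minimal (fun x hx => ?_) isClosed_closedBall
    obtain ⟨k, hk, hne⟩ := Finset.exists_ne_zero_of_sum_ne_zero (Function.mem_support.mp hx)
    have hΦne : Φ (x - h • siteToE k) ≠ 0 := fun h0 => hne (by rw [h0, smul_zero])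
    have h1 := hΦsupp (subset_tsupport _ (Function.mem_support.mpr hΦne))
    rw [mem_closedBall, dist_zero_right] at h1
    rw [mem_closedBall, dist_eq_norm]
    calc ‖x - c‖ ≤ ‖x - h • siteToE k‖ + ‖h • siteToE k - c‖ := norm_sub_le_norm_sub_add_norm_sub _ _ _
      _ ≤ τ * RK + ϱ := add_le_add h1 (norm_sub_le_of_mem_meshSet hk)
      _ = ϱ + RK * τ := by ring
  · -- the error bound
    intro m hm z
    have hfun : (fun x => kSmooth (combKernel b w u) τ f x - ∑ j, a j * b (τ⁻¹ • (x - η j))) =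
        fun x => (∫ y, f y • Φ (x - y)) - ∑ k ∈ S, (h ^ 4 * f (h • siteToE k)) • Φ (x - h • siteToE k) := by
      funext x
      rw [show (∑ j, a j * b (τ⁻¹ • (x - η j))) = ∑ k ∈ S, (h ^ 4 * f (h • siteToE k)) • Φ (x - h • siteToE k) from
        congrFun hrepr x]
      congr 1
      unfold kSmooth
      refine integral_congr_ae (Eventually.of_forall fun y => ?_)
      simp only [hΦ_def, hK, smul_eq_mul]
      ring
    rw [hfun]
    have key := norm_iteratedFDeriv_molliError_le f hf.continuous hA (div_nonneg hA hσ.le) hf0 hf1 hh S hS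
      (r := τ * RK) (mul_nonneg hτ.le hRK0) m Φ hΦd hΦsupp (fun j => (τ ^ 4)⁻¹ * (τ⁻¹) ^ j * D j) hMτ0 hΦM z
    rw [← hV₁] at key
    refine key.trans ?_
    -- bookkeeping of the constants
    have hDm : D (m + 1) + D m ≤ Dsum := by
      rw [hDsum, add_comm]
      have hsub : ({m, m + 1} : Finset ℕ) ⊆ Finset.range (N + 2) := by
        intro j hj
        simp only [Finset.mem_insert, Finset.mem_singleton] at hj
        rw [Finset.mem_range]; omega
      have := Finset.sum_le_sum_of_subset_of_nonneg hsub (fun j _ _ => hD0 j)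
      rwa [Finset.sum_pair (by omega : m ≠ m + 1)] at this
    have step1 : A * ((τ ^ 4)⁻¹ * τ⁻¹ ^ (m + 1) * D (m + 1)) + A / σ * ((τ ^ 4)⁻¹ * τ⁻¹ ^ m * D m) ≤
        A * ((τ ^ 4)⁻¹ * τ⁻¹ ^ (m + 1) * Dsum) := by
      have hAσ : A / σ ≤ A * τ⁻¹ := by
        rw [div_eq_mul_inv]; exact mul_le_mul_of_nonneg_left ((inv_le_inv₀ hσ hτ).2 hτσ) hA
      have h2 : A / σ * ((τ ^ 4)⁻¹ * τ⁻¹ ^ m * D m) ≤ A * τ⁻¹ * ((τ ^ 4)⁻¹ * τ⁻¹ ^ m * D m) :=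
        mul_le_mul_of_nonneg_right hAσ (hMτ0 m)
      have h3 : A * τ⁻¹ * ((τ ^ 4)⁻¹ * τ⁻¹ ^ m * D m) = A * ((τ ^ 4)⁻¹ * τ⁻¹ ^ (m + 1) * D m) := by ring
      have h4 : 0 ≤ A * ((τ ^ 4)⁻¹ * τ⁻¹ ^ (m + 1)) := by positivity
      rw [h3] at h2
      calc A * ((τ ^ 4)⁻¹ * τ⁻¹ ^ (m + 1) * D (m + 1)) + A / σ * ((τ ^ 4)⁻¹ * τ⁻¹ ^ m * D m)
          ≤ A * ((τ ^ 4)⁻¹ * τ⁻¹ ^ (m + 1) * D (m + 1)) + A * ((τ ^ 4)⁻¹ * τ⁻¹ ^ (m + 1) * D m) :=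
            add_le_add le_rfl h2
        _ = A * ((τ ^ 4)⁻¹ * τ⁻¹ ^ (m + 1)) * (D (m + 1) + D m) := by ring
        _ ≤ A * ((τ ^ 4)⁻¹ * τ⁻¹ ^ (m + 1)) * Dsum := mul_le_mul_of_nonneg_left hDm h4
        _ = A * ((τ ^ 4)⁻¹ * τ⁻¹ ^ (m + 1) * Dsum) := by ring
    have step2 : (τ * RK + 2 * h) ^ 4 * V₁ ≤ (τ * (RK + 2)) ^ 4 * V₁ := by
      have hlin : τ * RK + 2 * h ≤ τ * (RK + 2) := by rw [mul_add]; linarith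
      exact mul_le_mul_of_nonneg_right (pow_le_pow_left₀ (add_nonneg (mul_nonneg hτ.le hRK0) (by positivity)) hlin 4) hV₁0
    have step3 : 2 * h * (A * ((τ ^ 4)⁻¹ * τ⁻¹ ^ (m + 1) * D (m + 1)) + A / σ * ((τ ^ 4)⁻¹ * τ⁻¹ ^ m * D m)) *
        ((τ * RK + 2 * h) ^ 4 * V₁) ≤ 2 * h * (A * ((τ ^ 4)⁻¹ * τ⁻¹ ^ (m + 1) * Dsum)) * ((τ * (RK + 2)) ^ 4 * V₁) := by
      have h0 : 0 ≤ 2 * h := by positivity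
      have hP1 : 0 ≤ (τ * RK + 2 * h) ^ 4 * V₁ :=
        mul_nonneg (pow_nonneg (add_nonneg (mul_nonneg hτ.le hRK0) (by positivity)) 4) hV₁0
      have hP2 : 0 ≤ 2 * h * (A * ((τ ^ 4)⁻¹ * τ⁻¹ ^ (m + 1) * Dsum)) :=
        mul_nonneg h0 (mul_nonneg hA (mul_nonneg (by positivity) hDsum0))
      exact mul_le_mul (mul_le_mul_of_nonneg_left step1 h0) step2 hP1 hP2
    have step4 : 2 * h * (A * ((τ ^ 4)⁻¹ * τ⁻¹ ^ (m + 1) * Dsum)) * ((τ * (RK + 2)) ^ 4 * V₁) =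
        (2 * (RK + 2) ^ 4 * V₁ * Dsum) / m₀ * A / τ ^ m := by
      have hτ0 : τ ≠ 0 := hτ.ne'
      have hm0 : (m₀ : ℝ) ≠ 0 := hm₀pos.ne'
      rw [hh_def, inv_pow, pow_succ]
      field_simp
      ring
    rw [step4] at step3
    refine step3.trans ?_
    · have hc : 2 * (RK + 2) ^ 4 * V₁ * Dsum ≤ 7 ^ 4 * W + 2 * (RK + 2) ^ 4 * V₁ * Dsum :=
        le_add_of_nonneg_left (mul_nonneg (by norm_num) hW0)
      have : 0 ≤ A / τ ^ m := by positivity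
      calc 2 * (RK + 2) ^ 4 * V₁ * Dsum / m₀ * A / τ ^ m = (2 * (RK + 2) ^ 4 * V₁ * Dsum) * (A / τ ^ m / m₀) := by ring
        _ ≤ (7 ^ 4 * W + 2 * (RK + 2) ^ 4 * V₁ * Dsum) * (A / τ ^ m / m₀) :=
            mul_le_mul_of_nonneg_right hc (by positivity)
        _ = (7 ^ 4 * W + 2 * (RK + 2) ^ 4 * V₁ * Dsum) / m₀ * A / τ ^ m := by ring

/-- **H4b at the order used by the composition**: `RiemannDisc b 6` for every compactly supported Schwartz profile. -/
theorem riemannDisc_six (b : SchwartzMap E4 ℝ) : RiemannDisc b 6 := riemannDisc b 6 (by norm_num)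

end Summit.QuantumFields.YangMills.Cruxes.AtomicSynthesis.SingleSlotPlan

end
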